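import Mathlib.Analysis.Calculus.FDeriv.Symmetric
import Mathlib.Analysis.Calculus.DerivativeTest
import Mathlib.Algebra.QuadraticDiscriminant
import Mathlib.Analysis.Normed.Module.Connected
import Literature.Topology.FourManifolds.Trisections
import Literature.Topology.FourManifolds.SmoothOrientation
import Literature.Topology.FourManifolds.SmoothOrientationSphereProofs
import HarnessLib

/-!
# The vendored trisection predicate is unsatisfiable (refutation of `exists_isBalancedTrisection`)

Topic `Literature/Topology/FourManifolds`; companion to `Trisections.lean` (fact item
`provefact-Literature.exists_isBalancedTrisection`, Gay–Kirby 2016, Thm. 4).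

`Literature.IsTrisection X g k S` (`Trisections.lean`) asks that every sector `S i` be the image of a smooth
embedding `e : W → X` (Mathlib's `Manifold.IsSmoothEmbedding (𝓡∂ 4) (𝓡 4) ∞`: a topological embedding
which in suitable charts of the `C^∞` maximal atlases is a linear injection restricted to a piece of
the closed half-space) of a compact 4-manifold *with boundary*, that the other two sectors meet
`S i` only inside `e(∂W)`, and that the triple intersection `F = S 0 ∩ S 1 ∩ S 2` be `h(∂H)` for a
smoothly embedded genus-`g` handlebody `H` presented by a Morse function with one critical point of
index `0`, `g` of index `1` and none of index `2, 3` (`HasHandleDecomposition 2 H (handleCount 1 g)`).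

**This is contradictory**, for every `X`, `g`, `k`, `S` (`Literature.Topology.FourManifolds.TrisectionRefutation.not_isTrisection`):

1. *Triple points exist.* If `∂H = ∅`, the Morse function attains its maximum at an interior point,
   which is a nondegenerate critical point with negative-definite Hessian, i.e. of index `3`; as the
   index-`3` critical set has `ncard = 0` it is infinite, so the critical set accumulates at some
   `z*`; reading `f` in the immersion chart of `h` at `z*` (a chart of the maximal atlas, so
   `C^∞`-compatible with every preferred chart even without an `IsManifold` instance) shows that
   `d(f ∘ chart⁻¹)` vanishes at points accumulating to the image of `z*`, whence the Hessian at the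
   critical point `z*` has a kernel — contradicting the Morse condition. So `∂H ≠ ∅` and
   `F = h(∂H) ≠ ∅`.
2. *Three half-spaces.* At `x ∈ F` each `eᵢ⁻¹(x)` is a boundary point of `Wᵢ` and, in the preferred
   chart at `x`, the sector `S i` is to first order a closed half-space `{ℓᵢ ≥ 0}` (`ℓᵢ ≠ 0`): moving
   off `x` in a direction `u` with `ℓᵢ u > 0` one lands, for small `t > 0`, at `eᵢ(w')` with `w'`
   an *interior* point of `Wᵢ` (invariance of interior points under `C¹` coordinate changes), hence —
   by the clause `S i ∩ S j ⊆ eᵢ(∂Wᵢ)` — outside every other sector. So the open half-spaces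
   `{ℓᵢ > 0}`, `i = 0, 1, 2`, are pairwise disjoint, which is absurd.

The mathematical source of the defect: in Gay–Kirby's Definition 1 the pieces `Xᵢ` of
`X = X₁ ∪ X₂ ∪ X₃` are codimension-`0` submanifolds **with corners** along the central surface
`F` (locally `F × (sector of angle 2π/3)`), diffeomorphic to `Z_k = ♮ᵏ(S¹ × B³)` only after the corners
are smoothed; a decomposition of a 4-manifold into three smoothly embedded manifolds *with boundary*
meeting pairwise along their boundaries with a common codimension-2 stratum does not exist.

Consequences recorded here: `not_isBalancedTrisection`, `trisectionGenus_eq_top`, and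
`not_exists_isBalancedTrisection_of`: **any** closed connected oriented smooth 4-manifold `X : Type u`
refutes the named fact `Literature.exists_isBalancedTrisection.{u}`; with the named fact
`Literature.Topology.FourManifolds.isOrientable_sphere` the round `S⁴` does (`not_exists_isBalancedTrisection_of_isOrientable_sphere`);
since that fact is proved (`Literature.Topology.FourManifolds.isOrientable_sphere_holds`), `¬ exists_isBalancedTrisection.{0}` holds
unconditionally (`not_exists_isBalancedTrisection`).
(Verdict clean-up 2026-08-15: `exists_isBalancedTrisection` is now an `@[deprecated]` record at the
end of `Trisections.lean` — replacement `Literature.Topology.FourManifolds.exists_isBalancedGKTrisection` —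
kept only because the three refutation theorems below and the `GroupTrisection` thesis name it;
`linter.deprecated` is silenced on exactly those three theorems, whose statements are unchanged.)
Every statement quantifying over `IsTrisection`/`IsBalancedTrisection` (files `TrisectionFunctor`,
`TrisectionEuler`, `SmallTrisections`, thesis `SmoothPoincare4/GroupTrisection`) is therefore vacuous
until the predicate is repaired (see the corrected `Literature.Topology.FourManifolds.IsGKTrisection` in `Trisections.lean`).

## Contents

* Calculus: second-order necessary condition at a maximum, isotropic vectors of semidefinite forms,
  kernels of derivatives of maps vanishing on a set accumulating at a point, three half-spaces.
* Charts without `IsManifold`: `C^n` coordinate changes and invertibility of their derivatives from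
  one- or two-sided groupoid compatibility, chain rule through a coordinate change, invariance of
  interior points for a chart of the maximal atlas against the preferred chart (adapted from
  Mathlib's `ModelWithCorners.mem_interior_range_of_mem_interior_range_of_mem_atlas`).
* `boundary_nonempty_of_isMorse` (Part 1), `sector_halfSpace` (Part 2), `not_isTrisection`.

## References

* D. Gay, R. Kirby, *Trisecting 4-manifolds*, Geom. Topol. 20 (2016) 3097–3132 (arXiv:1205.1565):
  Def. 1 (p. 2), Thm. 4 (p. 3).
* J. Milnor, *Morse theory* (1963), §2 (nondegenerate critical points are isolated; index of a maximum).
* M. W. Hirsch, *Differential Topology* (1976), §1.4 (invariance of the boundary under diffeomorphisms).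
-/

open scoped Manifold ContDiff Topology
open Set Function Filter

noncomputable section

namespace Literature.Topology.FourManifolds

namespace TrisectionRefutation

/-! ### Calculus lemmas -/

section Calculus

variable {E : Type*} [NormedAddCommGroup E] [NormedSpace ℝ E]

/-- Second-order necessary condition at a global maximum of a `C²` function on a normed space: the
second derivative is negative semidefinite (Milnor 1963, §2). [folklore] -/
theorem fderiv_fderiv_apply_self_nonpos_of_forall_le {g : E → ℝ} {b : E}
    (hmax : ∀ y, g y ≤ g b) (hg : ContDiffAt ℝ 2 g b) (v : E) :
    fderiv ℝ (fderiv ℝ g) b v v ≤ 0 := by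
  by_contra hpos
  push Not at hpos
  set L := fderiv ℝ (fderiv ℝ g) b v v with hL
  have h1 : ContDiffAt ℝ 1 (fderiv ℝ g) b := hg.fderiv_right (by norm_num)
  have hdg : HasFDerivAt (fderiv ℝ g) (fderiv ℝ (fderiv ℝ g) b) b :=
    (h1.differentiableAt one_ne_zero).hasFDerivAt
  have hgd : ∀ᶠ y in 𝓝 b, DifferentiableAt ℝ g y := by
    have := hg.eventually (by simp)
    exact this.mono fun y hy => hy.differentiableAt (by norm_num)
  let γ : ℝ → E := fun t => b + t • v
  have hγ : ∀ t, HasDerivAt γ v t := fun t => by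
    simpa [γ] using ((hasDerivAt_id t).smul_const v).const_add b
  have hγ0 : γ 0 = b := by simp [γ]
  have hγc : Continuous γ := by fun_prop
  have hγt : Tendsto γ (𝓝 0) (𝓝 b) := by rw [← hγ0]; exact hγc.tendsto 0
  set ψ : ℝ → ℝ := g ∘ γ with hψdef
  -- first derivative of ψ near 0
  have hψ : ∀ᶠ t in 𝓝 (0:ℝ), HasDerivAt ψ (fderiv ℝ g (γ t) v) t := by
    filter_upwards [hγt.eventually hgd] with t ht
    exact ht.hasFDerivAt.comp_hasDerivAt t (hγ t)
  have hderivψ : deriv ψ =ᶠ[𝓝 0] fun t => fderiv ℝ g (γ t) v :=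
    hψ.mono fun t ht => ht.deriv
  -- second derivative of ψ at 0
  have hψ' : HasDerivAt (fun t => fderiv ℝ g (γ t) v) L 0 := by
    have h2 : HasDerivAt (fun t => fderiv ℝ g (γ t)) (fderiv ℝ (fderiv ℝ g) b v) 0 := by
      have hγ' : HasDerivAt γ v 0 := hγ 0
      have hdg' : HasFDerivAt (fderiv ℝ g) (fderiv ℝ (fderiv ℝ g) b) (γ 0) := hγ0 ▸ hdg
      exact hdg'.comp_hasDerivAt (0:ℝ) hγ'
    have := h2.clm_apply (hasDerivAt_const (0:ℝ) v)
    simpa using this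
  have hd2 : deriv (deriv ψ) 0 = L := by
    rw [hderivψ.deriv_eq]; exact hψ'.deriv
  have hd1 : deriv ψ 0 = 0 := by
    rw [hderivψ.eq_of_nhds, hγ0]
    have hloc : IsLocalMax g b := Filter.Eventually.of_forall fun y => hmax y
    rw [hloc.fderiv_eq_zero]; rfl
  have hcont : ContinuousAt ψ 0 :=
    (hψ.self_of_nhds).continuousAt
  have hmin : IsLocalMin ψ 0 := isLocalMin_of_deriv_deriv_pos (by rw [hd2]; exact hpos) hd1 hcont
  -- ψ is locally constant near 0, hence its second derivative vanishes there
  have hconst : ψ =ᶠ[𝓝 0] fun _ => ψ 0 := by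
    filter_upwards [hmin] with t ht
    exact le_antisymm (by simpa [ψ, hγ0] using hmax (γ t)) ht
  have hderiv0 : deriv ψ =ᶠ[𝓝 0] fun _ => 0 := by
    filter_upwards [hconst.eventually_nhds] with t (ht : ψ =ᶠ[𝓝 t] fun _ => ψ 0)
    rw [ht.deriv_eq]; simp
  have : deriv (deriv ψ) 0 = 0 := by rw [hderiv0.deriv_eq]; simp
  rw [hd2] at this
  exact hpos.ne' this

/-- For a symmetric negative semidefinite bilinear map, an isotropic vector lies in the kernel
(Cauchy–Schwarz via the discriminant). [folklore] -/
theorem apply_eq_zero_of_nonpos_of_apply_self_eq_zero (B : E →L[ℝ] E →L[ℝ] ℝ)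
    (hsymm : ∀ v w, B v w = B w v) (hle : ∀ v, B v v ≤ 0) {v : E} (hv : B v v = 0) (w : E) :
    B v w = 0 := by
  have hquad : ∀ t : ℝ, 0 ≤ (-B w w) * (t * t) + (-2 * B v w) * t + 0 := by
    intro t
    have := hle (v + t • w)
    simp only [map_add, map_smul, FunLike.coe_add, FunLike.coe_smul,
      Pi.add_apply, Pi.smul_apply, smul_eq_mul, hsymm w v, hv] at this
    nlinarith [this]
  have hd := discrim_le_zero hquad
  simp only [discrim, mul_zero, sub_zero] at hd
  nlinarith [sq_nonneg (B v w)]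

/-- If `Φ` is differentiable at `b`, `Φ b = 0`, and `Φ` vanishes at points `q ≠ b` arbitrarily close
to `b`, then the derivative of `Φ` at `b` has a nontrivial kernel (finite-dimensional source: an
injective linear map is bounded below). [folklore] -/
theorem exists_ne_zero_apply_eq_zero_of_frequently [FiniteDimensional ℝ E]
    {F : Type*} [NormedAddCommGroup F] [NormedSpace ℝ F]
    {Φ : E → F} {A : E →L[ℝ] F} {b : E} (hΦ : HasFDerivAt Φ A b) (h0 : Φ b = 0)
    (hfr : ∃ᶠ q in 𝓝 b, q ≠ b ∧ Φ q = 0) : ∃ v, v ≠ 0 ∧ A v = 0 := by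
  by_contra hcon
  push Not at hcon
  have hinj : Injective A := by
    rw [injective_iff_map_eq_zero]
    intro v hv
    by_contra h
    exact hcon v h hv
  -- `A` is bounded below
  obtain ⟨c, hc, hbound⟩ : ∃ c : ℝ, 0 < c ∧ ∀ v, c * ‖v‖ ≤ ‖A v‖ := by
    obtain ⟨K, hK, hanti⟩ := (LinearMap.injective_iff_antilipschitz (A : E →ₗ[ℝ] F)).mp hinj
    refine ⟨((K : ℝ) + 1)⁻¹, by positivity, fun v => ?_⟩
    have h1 := hanti.le_mul_dist v 0
    simp only [dist_zero_right, ContinuousLinearMap.coe_coe, map_zero] at h1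
    rw [inv_mul_le_iff₀ (by positivity)]
    nlinarith [norm_nonneg (A v)]
  have hlo := (hasFDerivAt_iff_isLittleO_nhds_zero.mp hΦ)
  rw [Asymptotics.isLittleO_iff] at hlo
  have hev := hlo (half_pos hc)
  -- transport to `𝓝 b`
  have hev' : ∀ᶠ q in 𝓝 b, ‖Φ q - Φ b - A (q - b)‖ ≤ c / 2 * ‖q - b‖ := by
    have ht : Tendsto (fun q => q - b) (𝓝 b) (𝓝 0) := by
      rw [← sub_self b]; exact tendsto_id.sub tendsto_const_nhds
    filter_upwards [ht.eventually hev] with q hq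
    simpa using hq
  obtain ⟨q, ⟨hqb, hq0⟩, hq⟩ := (hfr.and_eventually hev').exists
  rw [hq0, h0, sub_zero, zero_sub, norm_neg] at hq
  have hb := hbound (q - b)
  have hpos : 0 < ‖q - b‖ := norm_pos_iff.mpr (sub_ne_zero.mpr hqb)
  nlinarith

/-- If `c` has derivative `d > 0` at `0` and `c 0 ≥ 0`, then `c t > 0` for all small `t > 0`. [folklore] -/
theorem eventually_nhdsGT_pos_of_hasDerivAt {c : ℝ → ℝ} {d : ℝ} (hc : HasDerivAt c d 0)
    (hd : 0 < d) (h0 : 0 ≤ c 0) : ∀ᶠ t in 𝓝[>] (0:ℝ), 0 < c t := by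
  have hlo := hasDerivAt_iff_isLittleO.mp hc
  rw [Asymptotics.isLittleO_iff] at hlo
  have hev := hlo (half_pos hd)
  rw [eventually_nhdsWithin_iff]
  filter_upwards [hev] with t ht (htpos : 0 < t)
  simp only [sub_zero, smul_eq_mul, Real.norm_eq_abs, abs_of_pos htpos] at ht
  have := (abs_le.mp ht).1
  nlinarith

/-- Three nonzero linear functionals on a real vector space cannot have pairwise disjoint open
positive half-spaces `{ℓᵢ > 0}`. [folklore] -/
theorem three_halfSpaces {V : Type*} [AddCommGroup V] [Module ℝ V] (ℓ : Fin 3 → V →ₗ[ℝ] ℝ)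
    (hℓ : ∀ i, ℓ i ≠ 0)
    (hdis : ∀ i j, i ≠ j → ∀ u, ¬ (0 < ℓ i u ∧ 0 < ℓ j u)) : False := by
  -- a vector positive for ℓ 0
  have hex : ∀ i, ∃ v, ℓ i v = 1 := fun i => by
    obtain ⟨v, hv⟩ : ∃ v, ℓ i v ≠ 0 := by
      by_contra h; push Not at h; exact hℓ i (LinearMap.ext h)
    exact ⟨(ℓ i v)⁻¹ • v, by simp [hv]⟩
  obtain ⟨u, hu⟩ := hex 0
  -- ℓ j u < 0 for j = 1, 2
  have hneg : ∀ j, j ≠ (0 : Fin 3) → ℓ j u < 0 := by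
    intro j hj
    by_contra hge
    push Not at hge
    obtain ⟨v, hv⟩ := hex j
    set ε : ℝ := 1 / (2 * (|ℓ 0 v| + 1)) with hε
    have hεpos : 0 < ε := by positivity
    refine hdis 0 j hj.symm (u + ε • v) ⟨?_, ?_⟩
    · simp only [map_add, map_smul, smul_eq_mul, hu]
      have h1 : ε * |ℓ 0 v| < 1 := by
        rw [hε, div_mul_eq_mul_div, one_mul, div_lt_one (by positivity)]
        nlinarith [abs_nonneg (ℓ 0 v)]
      nlinarith [neg_abs_le (ℓ 0 v), hεpos]
    · simp only [map_add, map_smul, smul_eq_mul, hv]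
      linarith
  refine hdis 1 2 (by decide) (-u) ⟨?_, ?_⟩
  · simpa using hneg 1 (by decide)
  · simpa using hneg 2 (by decide)

end Calculus

/-! ### Chart-change lemmas without `IsManifold` -/

section Charts

variable {E H M F' : Type*} [NormedAddCommGroup E] [NormedSpace ℝ E] [TopologicalSpace H]
  {I : ModelWithCorners ℝ E H} [TopologicalSpace M]
  [NormedAddCommGroup F'] [NormedSpace ℝ F']

/-- Smoothness of an extended coordinate change `e → e'` from the one-sided compatibility
`e.symm ≫ₕ e' ∈ contDiffGroupoid n I` (no `IsManifold` instance needed). [folklore] -/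
theorem contDiffOn_extendCoordChange_of_mem_groupoid {n : ℕ∞ω} {e e' : OpenPartialHomeomorph M H}
    (h : e.symm ≫ₕ e' ∈ contDiffGroupoid n I) :
    ContDiffOn ℝ n (I.extendCoordChange e e') (I.extendCoordChange e e').source := by
  rw [I.extendCoordChange_source, I.image_eq]
  exact h.1

/-- Chain rule through a `C^n` coordinate change (`n ≠ 0`): a derivative (within the model range)
of `g` read in the chart `e'` yields a derivative of `g` read in the chart `e`, under the one-sided
compatibility `e.symm ≫ₕ e' ∈ contDiffGroupoid n I`; no `IsManifold` instance is used. [folklore] -/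
theorem hasFDerivWithinAt_comp_extend_symm {n : ℕ∞ω} (hn : n ≠ 0)
    {e e' : OpenPartialHomeomorph M H} (h : e.symm ≫ₕ e' ∈ contDiffGroupoid n I)
    {x : M} (hxe : x ∈ e.source) (hxe' : x ∈ e'.source) {g : M → F'} {D : E →L[ℝ] F'}
    (hg : HasFDerivWithinAt (g ∘ (e'.extend I).symm) D (range I) (e'.extend I x)) :
    HasFDerivWithinAt (g ∘ (e.extend I).symm)
      (D.comp (fderivWithin ℝ (I.extendCoordChange e e') (range I) (e.extend I x)))
      (range I) (e.extend I x) := by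
  set σ := I.extendCoordChange e e' with hσdef
  have hsrc : e.extend I x ∈ σ.source := by
    rw [hσdef, ← OpenPartialHomeomorph.extend_image_source_inter]
    exact mem_image_of_mem _ ⟨hxe, hxe'⟩
  have hσ : ContDiffWithinAt ℝ n σ (range I) (e.extend I x) :=
    ((contDiffOn_extendCoordChange_of_mem_groupoid h) _ hsrc).mono_of_mem_nhdsWithin
      (I.extendCoordChange_source_mem_nhdsWithin' hxe hxe')
  have hσd : HasFDerivWithinAt σ (fderivWithin ℝ σ (range I) (e.extend I x)) (range I)
      (e.extend I x) :=
    (hσ.differentiableWithinAt hn).hasFDerivWithinAt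
  have hσx : σ (e.extend I x) = e'.extend I x := by
    simp [hσdef, e.left_inv hxe]
  have hmaps : MapsTo σ (range I) (range I) := fun y _ => by
    simp only [hσdef, PartialEquiv.coe_trans, comp_apply, OpenPartialHomeomorph.extend_coe]
    exact mem_range_self _
  rw [← hσx] at hg
  have hcomp := hg.comp (e.extend I x) hσd hmaps
  refine hcomp.congr_of_eventuallyEq ?_ ?_
  · have hmem : σ.source ∈ 𝓝[range I] (e.extend I x) :=
      I.extendCoordChange_source_mem_nhdsWithin' hxe hxe'
    filter_upwards [hmem] with y hy
    have hy' : (e.extend I).symm y ∈ e'.source := by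
      have := hy.2
      simpa [PartialEquiv.trans_source] using this
    simp only [comp_apply, hσdef, PartialEquiv.coe_trans]
    rw [e'.extend_left_inv (I := I) hy']
  · simp only [comp_apply, hσx, e'.extend_left_inv (I := I) hxe', e.extend_left_inv (I := I) hxe]

/-- Invertibility of the derivative of the coordinate change between two mutually `C^n`-compatible
charts (`n ≠ 0`); this is Mathlib's `ModelWithCorners.isInvertible_fderivWithin_extendCoordChange`
with the maximal-atlas hypotheses replaced by the two groupoid memberships they are used for. [folklore] -/
theorem isInvertible_fderivWithin_extendCoordChange_of_mem_groupoid {n : ℕ∞ω} (hn : n ≠ 0)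
    {e e' : OpenPartialHomeomorph M H} (h : e.symm ≫ₕ e' ∈ contDiffGroupoid n I)
    (h' : e'.symm ≫ₕ e ∈ contDiffGroupoid n I)
    {x : E} (hx : x ∈ (I.extendCoordChange e e').source) :
    ContinuousLinearMap.IsInvertible <|
      fderivWithin ℝ (I.extendCoordChange e e') (I.extendCoordChange e e').source x := by
  set φ := I.extendCoordChange e e'
  have hφ : ContDiffOn ℝ n φ φ.source := contDiffOn_extendCoordChange_of_mem_groupoid h
  have hφ' : ContDiffOn ℝ n φ.symm φ.target := contDiffOn_extendCoordChange_of_mem_groupoid h'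
  refine .of_inverse (g := (fderivWithin ℝ φ.symm φ.target (φ x))) ?_ ?_
  · rw [← φ.left_inv hx, φ.right_inv (φ.map_source hx), ← fderivWithin_comp,
      fderivWithin_congr' φ.rightInvOn.eqOn (φ.map_source hx), fderivWithin_id]
    · exact I.uniqueDiffOn_extendCoordChange_source _ (φ.map_source hx)
    · exact (φ.left_inv hx ▸ ((hφ _ hx).differentiableWithinAt hn) :)
    · exact (hφ' _ (φ.map_source hx)).differentiableWithinAt hn
    · exact φ.mapsTo_symm
    · exact I.uniqueDiffOn_extendCoordChange_source _ (φ.map_source hx)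
  · rw [← fderivWithin_comp, fderivWithin_congr' φ.leftInvOn.eqOn hx, fderivWithin_id]
    · exact I.uniqueDiffOn_extendCoordChange_source _ hx
    · exact (hφ' _ (φ.map_source hx)).differentiableWithinAt hn
    · exact (hφ _ hx).differentiableWithinAt hn
    · exact φ.mapsTo
    · exact I.uniqueDiffOn_extendCoordChange_source _ hx

/-- **Invariance of interior points** (Hirsch, *Differential Topology*, §1.4) for a chart `φ` of the
`C^n` maximal atlas (`n ≠ 0`) against the preferred chart, *without* an `IsManifold` instance: if `φ`
sends `w ∈ φ.source` into the interior of `range I`, then `w` is an interior point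
(`I.IsInteriorPoint w`, defined through `chartAt w`). Adapted from Mathlib's
`ModelWithCorners.mem_interior_range_of_mem_interior_range_of_mem_atlas`. [folklore] -/
theorem isInteriorPoint_of_mem_maximalAtlas [ChartedSpace H M] {n : ℕ∞ω} (hn : n ≠ 0)
    {φ : OpenPartialHomeomorph M H} (hφ : φ ∈ IsManifold.maximalAtlas I n M) {w : M}
    (hw : w ∈ φ.source) (hint : φ.extend I w ∈ interior (range I)) : I.IsInteriorPoint w := by
  set σ := I.extendCoordChange φ (chartAt H w) with hσdef
  have h₁ : φ.symm ≫ₕ chartAt H w ∈ contDiffGroupoid n I :=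
    StructureGroupoid.compatible_of_mem_maximalAtlas_left hφ
  have h₂ : (chartAt H w).symm ≫ₕ φ ∈ contDiffGroupoid n I :=
    StructureGroupoid.compatible_of_mem_maximalAtlas_right hφ
  have hσ : ContDiffOn ℝ n σ σ.source := contDiffOn_extendCoordChange_of_mem_groupoid h₁
  have hsrc : φ.extend I w ∈ σ.source := by
    rw [hσdef, ← OpenPartialHomeomorph.extend_image_source_inter]
    exact mem_image_of_mem _ ⟨hw, mem_chart_source H w⟩
  -- `σ.source` is a neighbourhood of `φ.extend I w`
  have hσx : σ.source ∈ 𝓝 (φ.extend I w) := by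
    have h1 : σ.source ∈ 𝓝[range I] (φ.extend I w) :=
      I.extendCoordChange_source_mem_nhdsWithin' hw (mem_chart_source H w)
    have h2 : range I ∈ 𝓝 (φ.extend I w) := mem_interior_iff_mem_nhds.mp hint
    rw [← nhdsWithin_eq_nhds.mpr h2]
    exact h1
  have hdiff : DifferentiableAt ℝ σ (φ.extend I w) :=
    ((hσ _ hsrc).contDiffAt hσx).differentiableAt hn
  have hsurj : Function.Surjective (fderiv ℝ σ (φ.extend I w)) := by
    have hinv := isInvertible_fderivWithin_extendCoordChange_of_mem_groupoid hn h₁ h₂ hsrc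
    rw [fderivWithin_of_mem_nhds hσx] at hinv
    exact hinv.surjective
  have hmem := hdiff.mem_interior_convex_of_surjective_fderiv hσx I.convex_range I.isClosed_range
    I.nonempty_interior (fun y hy => ?_) hsurj
  · rw [ModelWithCorners.IsInteriorPoint, extChartAt]
    convert hmem using 1
    simp [hσdef, φ.left_inv hw]
  · simp only [hσdef, PartialEquiv.coe_trans, comp_apply, OpenPartialHomeomorph.extend_coe]
    exact mem_range_self _

end Charts

/-! ### Morse functions read in the preferred chart at an interior point -/

section InteriorCalculus

variable {E H M : Type*} [NormedAddCommGroup E] [NormedSpace ℝ E] [TopologicalSpace H]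
  {I : ModelWithCorners ℝ E H} [TopologicalSpace M] [ChartedSpace H M]

/-- A real function written in extended charts is the function precomposed with the inverse chart
(the chart of `ℝ` is the identity). [folklore] -/
theorem writtenInExtChartAt_real (f : M → ℝ) (z : M) :
    writtenInExtChartAt I 𝓘(ℝ, ℝ) z f = f ∘ (extChartAt I z).symm := by
  ext y; simp [writtenInExtChartAt]

/-- At an interior point, `C^n` in the manifold sense gives `C^n` (at the point, in the ordinary sense)
of the function read in the preferred extended chart. [folklore] -/
theorem contDiffAt_comp_extChartAt_symm {n : ℕ∞ω} {f : M → ℝ} {z : M}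
    (hf : ContMDiffAt I 𝓘(ℝ, ℝ) n f z) (hz : I.IsInteriorPoint z) :
    ContDiffAt ℝ n (f ∘ (extChartAt I z).symm) (extChartAt I z z) := by
  have h := (contMDiffAt_iff.mp hf).2
  have heq : (extChartAt 𝓘(ℝ, ℝ) (f z)) ∘ f ∘ (extChartAt I z).symm = f ∘ (extChartAt I z).symm := by
    ext y; simp
  rw [heq] at h
  exact h.contDiffAt (mem_interior_iff_mem_nhds.mp hz)

/-- At an interior point the manifold derivative of a differentiable real function is the Fréchet
derivative of the function read in the preferred extended chart. [folklore] -/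
theorem mfderiv_eq_fderiv_of_isInteriorPoint {f : M → ℝ} {z : M}
    (hf : MDifferentiableAt I 𝓘(ℝ, ℝ) f z) (hz : I.IsInteriorPoint z) :
    mfderiv I 𝓘(ℝ, ℝ) f z = fderiv ℝ (f ∘ (extChartAt I z).symm) (extChartAt I z z) := by
  rw [hf.mfderiv, writtenInExtChartAt_real, fderivWithin_of_mem_nhds (mem_interior_iff_mem_nhds.mp hz)]

/-- At an interior point the Hessian `Literature.Topology.FourManifolds.mhessian` is the second Fréchet derivative of the function
read in the preferred extended chart (Milnor 1963, §2). [folklore] -/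
theorem mhessian_apply_of_isInteriorPoint {f : M → ℝ} {z : M} (hz : I.IsInteriorPoint z)
    (v w : E) :
    mhessian I f z v w =
      fderiv ℝ (fderiv ℝ (f ∘ (extChartAt I z).symm)) (extChartAt I z z) v w := by
  set g := f ∘ (extChartAt I z).symm
  set b := extChartAt I z z
  have hb : range I ∈ 𝓝 b := mem_interior_iff_mem_nhds.mp hz
  have hK : fderivWithin ℝ (fderivWithin ℝ g (range I)) (range I) b = fderiv ℝ (fderiv ℝ g) b := by
    rw [fderivWithin_of_mem_nhds hb]
    apply Filter.EventuallyEq.fderiv_eq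
    filter_upwards [isOpen_interior.mem_nhds hz] with y hy
    exact fderivWithin_of_mem_nhds (mem_interior_iff_mem_nhds.mp hy)
  simp only [mhessian, writtenInExtChartAt_real]
  change (fderivWithin ℝ (fderivWithin ℝ g (range I)) (range I) b v) w = _
  rw [hK]

/-- At an interior point the Hessian of a `C²` function is symmetric (Schwarz; Milnor 1963, §2). [folklore] -/
theorem mhessian_symm_of_isInteriorPoint {n : ℕ∞ω} {f : M → ℝ} {z : M}
    (hf : ContMDiffAt I 𝓘(ℝ, ℝ) n f z) (hn : 2 ≤ n) (hz : I.IsInteriorPoint z) (v w : E) :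
    mhessian I f z v w = mhessian I f z w v := by
  rw [mhessian_apply_of_isInteriorPoint hz, mhessian_apply_of_isInteriorPoint hz]
  have h2 : ContDiffAt ℝ 2 (f ∘ (extChartAt I z).symm) (extChartAt I z z) :=
    (contDiffAt_comp_extChartAt_symm hf hz).of_le hn
  exact h2.isSymmSndFDerivAt (by simp) v w

end InteriorCalculus

/-! ### Part 1: a Morse function without top-index critical points forces nonempty boundary -/

section Boundary

variable {m : ℕ} {N : Type*} [TopologicalSpace N] [ChartedSpace (EuclideanHalfSpace (m + 1)) N]

/-- A global maximum of a Morse function attained at an interior point is a critical point of index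
`dim` (its Hessian is negative semidefinite and nondegenerate, hence negative definite;
Milnor 1963, §2). [folklore] -/
theorem mem_criticalSetOfIndex_top_of_isMaxOn {f : N → ℝ} (hf : IsMorse (𝓡∂ (m + 1)) f) {z : N}
    (hmax : ∀ y, f y ≤ f z) (hz : (𝓡∂ (m + 1)).IsInteriorPoint z) :
    z ∈ criticalSetOfIndex (𝓡∂ (m + 1)) f (m + 1) := by
  set g := f ∘ (extChartAt (𝓡∂ (m + 1)) z).symm with hgdef
  set b := extChartAt (𝓡∂ (m + 1)) z z with hbdef
  have hsmooth : ContMDiffAt (𝓡∂ (m + 1)) 𝓘(ℝ, ℝ) ∞ f z := hf.1 z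
  have hg : ContDiffAt ℝ ∞ g b := contDiffAt_comp_extChartAt_symm hsmooth hz
  have hg2 : ContDiffAt ℝ 2 g b := hg.of_le (WithTop.coe_le_coe.mpr le_top)
  have hgmax : ∀ y, g y ≤ g b := fun y => by
    simp only [hgdef, hbdef, comp_apply, extChartAt_to_inv]
    exact hmax _
  have hcrit : IsMCriticalPt (𝓡∂ (m + 1)) f z := by
    have hloc : IsLocalMax g b := Filter.Eventually.of_forall hgmax
    rw [IsMCriticalPt, mfderiv_eq_fderiv_of_isInteriorPoint (hsmooth.mdifferentiableAt (by simp)) hz]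
    exact hloc.fderiv_eq_zero
  refine ⟨hcrit, le_antisymm ?_ ?_⟩
  · simpa using morseIndex_le_finrank (𝓡∂ (m + 1)) f z
  · -- the Hessian is negative definite
    have hnd := hf.2 z hcrit
    set Q := (mhessian (𝓡∂ (m + 1)) f z).toQuadraticMap with hQ
    have hQapply : ∀ v, Q v = fderiv ℝ (fderiv ℝ g) b v v := fun v => by
      rw [hQ, LinearMap.BilinMap.toQuadraticMap_apply, mhessian_apply_of_isInteriorPoint hz]
    have hle : ∀ v, fderiv ℝ (fderiv ℝ g) b v v ≤ 0 :=
      fderiv_fderiv_apply_self_nonpos_of_forall_le hgmax hg2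
    have hsymm : ∀ v w, fderiv ℝ (fderiv ℝ g) b v w = fderiv ℝ (fderiv ℝ g) b w v :=
      hg2.isSymmSndFDerivAt (by simp)
    have hposdef : ((-Q).restrict ⊤).PosDef := by
      intro x hx
      have hx' : (x : (EuclideanSpace ℝ (Fin (m + 1)))) ≠ 0 := fun h => hx (Subtype.ext h)
      change 0 < (-Q) x
      rw [QuadraticMap.neg_apply, hQapply, neg_pos]
      refine lt_of_le_of_ne (hle _) fun h0 => hx' ?_
      refine hnd.1 (x : (EuclideanSpace ℝ (Fin (m + 1)))) fun w => ?_
      rw [mhessian_apply_of_isInteriorPoint hz]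
      exact apply_eq_zero_of_nonpos_of_apply_self_eq_zero _ hsymm hle h0 w
    have h := le_sigNeg_of_negDef Q hposdef
    rw [finrank_top, finrank_euclideanSpace_fin] at h
    exact h

/-- **Part 1.** On a compact nonempty manifold charted on the half-space `ℝ^{m+1}_{≥ 0}` every
point of which lies in the source of some chart of the `C^∞` maximal atlas, a Morse function with
no critical points of index `m + 1` (counted with `Set.ncard`, so: none or infinitely many) can only
exist if the boundary is nonempty (Milnor 1963, §2: nondegenerate critical points are isolated). [folklore] -/
theorem boundary_nonempty_of_isMorse [CompactSpace N] [Nonempty N] {f : N → ℝ}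
    (hf : IsMorse (𝓡∂ (m + 1)) f) (htop : (criticalSetOfIndex (𝓡∂ (m + 1)) f (m + 1)).ncard = 0)
    (hatlas : ∀ z : N, ∃ φ ∈ IsManifold.maximalAtlas (𝓡∂ (m + 1)) ∞ N, z ∈ φ.source) :
    ((𝓡∂ (m + 1)).boundary N).Nonempty := by
  by_contra hbd
  simp only [Set.not_nonempty_iff_eq_empty] at hbd
  have hint : ∀ z : N, (𝓡∂ (m + 1)).IsInteriorPoint z := fun z => by
    have : z ∈ (𝓡∂ (m + 1)).interior N := by
      rw [← ModelWithCorners.compl_boundary, hbd, compl_empty]; exact mem_univ z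
    exact this
  -- Step A/B: a maximum is a critical point of top index, so the critical set is infinite
  obtain ⟨z₀, -, hz₀⟩ := isCompact_univ.exists_isMaxOn univ_nonempty
    (hf.1.continuous.continuousOn (s := univ))
  have hmax : ∀ y, f y ≤ f z₀ := fun y => hz₀ (mem_univ y)
  have hmem := mem_criticalSetOfIndex_top_of_isMaxOn hf hmax (hint z₀)
  have hinf : (criticalSet (𝓡∂ (m + 1)) f).Infinite := by
    refine Set.Infinite.mono (criticalSetOfIndex_subset (𝓡∂ (m + 1)) f (m + 1)) fun hfin => ?_
    have := (Set.ncard_pos hfin).mpr ⟨z₀, hmem⟩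
    omega
  -- Step D: accumulation point of the critical set
  obtain ⟨zs, hacc⟩ := hinf.exists_accPt_principal
  obtain ⟨φ, hφ, hzsφ⟩ := hatlas zs
  set ψ := extChartAt (𝓡∂ (m + 1)) zs with hψdef
  set bs := ψ zs with hbsdef
  set gs := f ∘ ψ.symm with hgsdef
  have hbs : bs ∈ interior (range (𝓡∂ (m + 1))) := hint zs
  have hsmooth : ContMDiffAt (𝓡∂ (m + 1)) 𝓘(ℝ, ℝ) ∞ f zs := hf.1 zs
  have hgs : ContDiffAt ℝ ∞ gs bs := contDiffAt_comp_extChartAt_symm hsmooth (hint zs)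
  have hgs1 : ContDiffAt ℝ 1 (fderiv ℝ gs) bs := hgs.fderiv_right (WithTop.coe_le_coe.mpr le_top)
  have hderiv : HasFDerivAt (fderiv ℝ gs) (fderiv ℝ (fderiv ℝ gs) bs) bs :=
    (hgs1.differentiableAt one_ne_zero).hasFDerivAt
  have hcont : ContinuousAt (fderiv ℝ gs) bs := hgs1.continuousAt
  -- Step F: critical points near `zs` are zeros of `fderiv gs`
  have hev : ∀ᶠ z in 𝓝 zs, z ∈ φ.source ∧ z ∈ (chartAt (EuclideanHalfSpace (m + 1)) zs).source ∧ ψ z ∈ interior (range (𝓡∂ (m + 1))) := by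
    refine Filter.Eventually.and (φ.open_source.mem_nhds hzsφ) (Filter.Eventually.and
      ((chartAt (EuclideanHalfSpace (m + 1)) zs).open_source.mem_nhds (mem_chart_source _ zs)) ?_)
    exact (continuousAt_extChartAt zs).preimage_mem_nhds (isOpen_interior.mem_nhds hbs)
  have hkey : ∀ z, z ∈ φ.source → z ∈ (chartAt (EuclideanHalfSpace (m + 1)) zs).source → ψ z ∈ interior (range (𝓡∂ (m + 1))) →
      z ∈ criticalSet (𝓡∂ (m + 1)) f → fderiv ℝ gs (ψ z) = 0 := by
    intro z hzφ hzχ hzint hzc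
    -- derivative zero in the chart at `z`
    have h1 : HasFDerivWithinAt (f ∘ ((chartAt (EuclideanHalfSpace (m + 1)) z).extend (𝓡∂ (m + 1))).symm) (0 : (EuclideanSpace ℝ (Fin (m + 1))) →L[ℝ] ℝ) (range (𝓡∂ (m + 1)))
        ((chartAt (EuclideanHalfSpace (m + 1)) z).extend (𝓡∂ (m + 1)) z) := by
      have hmd : MDifferentiableAt (𝓡∂ (m + 1)) 𝓘(ℝ, ℝ) f z := (hf.1 z).mdifferentiableAt (by simp)
      have := hmd.hasMFDerivAt.2
      rw [writtenInExtChartAt_real] at this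
      rw [mem_criticalSet, IsMCriticalPt] at hzc
      rw [hzc] at this
      exact this
    -- transfer to the chart `φ`
    have h2 := hasFDerivWithinAt_comp_extend_symm (I := (𝓡∂ (m + 1))) (by simp)
      (StructureGroupoid.compatible_of_mem_maximalAtlas_left hφ) hzφ (mem_chart_source _ z) h1
    rw [ContinuousLinearMap.zero_comp] at h2
    -- transfer to the chart at `zs`
    have h3 := hasFDerivWithinAt_comp_extend_symm (I := (𝓡∂ (m + 1))) (by simp)
      (StructureGroupoid.compatible_of_mem_maximalAtlas_right hφ) hzχ hzφ h2
    rw [ContinuousLinearMap.zero_comp] at h3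
    exact (h3.hasFDerivAt (mem_interior_iff_mem_nhds.mp hzint)).fderiv
  have hfreqN : ∃ᶠ z in 𝓝 zs, ψ z ≠ bs ∧ fderiv ℝ gs (ψ z) = 0 := by
    have hfr := accPt_iff_frequently.mp hacc
    refine (hfr.and_eventually hev).mp (Filter.Eventually.of_forall ?_)
    rintro z ⟨⟨hne, hzc⟩, hzφ, hzχ, hzint⟩
    refine ⟨fun heq => hne ?_, hkey z hzφ hzχ hzint hzc⟩
    have := congr_arg ψ.symm heq
    rwa [hbsdef, extChartAt_to_inv, hψdef, (extChartAt (𝓡∂ (m + 1)) zs).left_inv (by simpa using hzχ)] at this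
  have hfreq : ∃ᶠ q in 𝓝 bs, q ≠ bs ∧ fderiv ℝ gs q = 0 := by
    have h : ∃ᶠ q in Filter.map ψ (𝓝 zs), q ≠ bs ∧ fderiv ℝ gs q = 0 :=
      Filter.frequently_map.mpr hfreqN
    exact h.filter_mono (continuousAt_extChartAt zs)
  -- Step G: `fderiv gs bs = 0` and the second derivative has a kernel
  have h0 : fderiv ℝ gs bs = 0 := by
    by_contra hne
    obtain ⟨q, ⟨-, hq⟩, hq'⟩ := (hfreq.and_eventually (hcont.eventually_ne hne)).exists
    exact hq' hq
  obtain ⟨v, hv, hAv⟩ := exists_ne_zero_apply_eq_zero_of_frequently hderiv h0 hfreq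
  -- Step H: contradiction with nondegeneracy at `zs`
  have hcrit : IsMCriticalPt (𝓡∂ (m + 1)) f zs := by
    rw [IsMCriticalPt, mfderiv_eq_fderiv_of_isInteriorPoint (hsmooth.mdifferentiableAt (by simp))
      (hint zs)]
    exact h0
  have hnd := hf.2 zs hcrit
  refine hv (hnd.1 v fun w => ?_)
  rw [mhessian_apply_of_isInteriorPoint (hint zs)]
  change (fderiv ℝ (fderiv ℝ gs) bs v) w = 0
  rw [hAv]; rfl

end Boundary

/-! ### Part 2: local analysis of a sector at a point of its boundary stratum -/

section Sector

variable {X : Type*} [TopologicalSpace X] [ChartedSpace (EuclideanSpace ℝ (Fin 4)) X]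
  {W : Type*} [TopologicalSpace W] [ChartedSpace (EuclideanHalfSpace 4) W]

/-- **Sector lemma.** Let `S i = range e` for a smooth embedding `e : W → X` of a manifold with
boundary such that the other sectors meet `S i` only along `e(∂W)`, and let `x ∈ S i`. Then there is
a nonzero linear functional `ℓ` on the model space such that, in the preferred chart at `x`, moving
off `x` in any direction `u` with `ℓ u > 0` one stays (for small positive times) inside `S i` and
outside every other sector. [folklore] -/
theorem sector_halfSpace {e : W → X} (hemb : Manifold.IsSmoothEmbedding (𝓡∂ 4) (𝓡 4) ∞ e)
    {S : Fin 3 → Set X} {i : Fin 3} (hrange : range e = S i)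
    (hbd : ∀ j, j ≠ i → S i ∩ S j ⊆ e '' (𝓡∂ 4).boundary W) {x : X} (hx : x ∈ S i) :
    ∃ ℓ : (EuclideanSpace ℝ (Fin 4)) →L[ℝ] ℝ, ℓ ≠ 0 ∧ ∀ u, 0 < ℓ u → ∀ᶠ t in 𝓝[>] (0:ℝ),
      (extChartAt (𝓡 4) x).symm (extChartAt (𝓡 4) x x + t • u) ∈ S i ∧
      ∀ j, j ≠ i → (extChartAt (𝓡 4) x).symm (extChartAt (𝓡 4) x x + t • u) ∉ S j := by
  -- the point of `W` over `x` and the immersion charts there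
  obtain ⟨w, hw⟩ : x ∈ range e := hrange ▸ hx
  set imm := hemb.isImmersion.isImmersionAt w with himm
  set φ := imm.domChart with hφdef
  set ψ := imm.codChart with hψdef
  set A := imm.equiv with hAdef
  have hφatlas : φ ∈ IsManifold.maximalAtlas (𝓡∂ 4) ∞ W := imm.domChart_mem_maximalAtlas
  have hψatlas : ψ ∈ IsManifold.maximalAtlas (𝓡 4) ∞ X := imm.codChart_mem_maximalAtlas
  have hwφ : w ∈ φ.source := imm.mem_domChart_source
  have hxψ : x ∈ ψ.source := hw ▸ imm.mem_codChart_source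
  have hwritten : ∀ k ∈ (φ.extend (𝓡∂ 4)).target,
      ψ.extend (𝓡 4) (e ((φ.extend (𝓡∂ 4)).symm k)) = A (k, 0) :=
    fun k hk => imm.writtenInCharts hk
  -- the linear model `Λ` of `e` in these charts is a linear automorphism of `(EuclideanSpace ℝ (Fin 4))`
  set Λ : (EuclideanSpace ℝ (Fin 4)) →L[ℝ] (EuclideanSpace ℝ (Fin 4)) := (A : ((EuclideanSpace ℝ (Fin 4)) × imm.complement) →L[ℝ] (EuclideanSpace ℝ (Fin 4))).comp
    (ContinuousLinearMap.inl ℝ (EuclideanSpace ℝ (Fin 4)) imm.complement) with hΛdef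
  have hΛA : ∀ k, Λ k = A (k, 0) := fun k => rfl
  have hΛinj : Function.Injective Λ := by
    intro k k' hk
    simpa [hΛA] using hk
  have hΛbij : Function.Bijective Λ :=
    ⟨hΛinj, (LinearMap.injective_iff_surjective (f := (Λ : (EuclideanSpace ℝ (Fin 4)) →ₗ[ℝ] (EuclideanSpace ℝ (Fin 4))))).mp hΛinj⟩
  set Λe : (EuclideanSpace ℝ (Fin 4)) ≃L[ℝ] (EuclideanSpace ℝ (Fin 4)) :=
    (LinearEquiv.ofBijective (Λ : (EuclideanSpace ℝ (Fin 4)) →ₗ[ℝ] (EuclideanSpace ℝ (Fin 4))) hΛbij).toContinuousLinearEquiv with hΛedef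
  have hΛe : ∀ k, Λe k = Λ k := fun k => rfl
  have hΛe_symm : ∀ k, Λe.symm (Λ k) = k := fun k => by
    rw [← hΛe]; exact Λe.symm_apply_apply k
  -- charts on `X`: the preferred chart `χ` at `x` and the coordinate change `κ` to `ψ`
  set χ := chartAt (EuclideanSpace ℝ (Fin 4)) x with hχdef
  have hext : extChartAt (𝓡 4) x = χ.extend (𝓡 4) := rfl
  set p := extChartAt (𝓡 4) x x with hpdef
  set κ := (𝓡 4).extendCoordChange χ ψ with hκdef
  have h₁ : χ.symm ≫ₕ ψ ∈ contDiffGroupoid ∞ (𝓡 4) :=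
    StructureGroupoid.compatible_of_mem_maximalAtlas_right hψatlas
  have h₂ : ψ.symm ≫ₕ χ ∈ contDiffGroupoid ∞ (𝓡 4) :=
    StructureGroupoid.compatible_of_mem_maximalAtlas_left hψatlas
  have hpsrc : p ∈ κ.source := by
    rw [hκdef, ← OpenPartialHomeomorph.extend_image_source_inter]
    exact mem_image_of_mem _ ⟨mem_chart_source _ x, hxψ⟩
  have hκsrc_nhds : κ.source ∈ 𝓝 p := by
    have := (𝓡 4).extendCoordChange_source_mem_nhdsWithin' (e := χ) (e' := ψ)
      (mem_chart_source _ x) hxψ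
    rwa [ModelWithCorners.range_eq_univ, nhdsWithin_univ] at this
  have hκdiff : ContDiffAt ℝ ∞ κ p :=
    ((contDiffOn_extendCoordChange_of_mem_groupoid h₁) p hpsrc).contDiffAt hκsrc_nhds
  set R := fderiv ℝ κ p with hRdef
  have hκderiv : HasFDerivAt κ R p := (hκdiff.differentiableAt (by simp)).hasFDerivAt
  have hRinv : R.IsInvertible := by
    have := isInvertible_fderivWithin_extendCoordChange_of_mem_groupoid (I := 𝓡 4) (n := ∞)
      (by simp) h₁ h₂ hpsrc
    rwa [fderivWithin_of_mem_nhds hκsrc_nhds] at this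
  obtain ⟨Re, hRe⟩ := hRinv
  -- base points in the charts
  set a := φ.extend (𝓡∂ 4) w with hadef
  have hatgt : a ∈ (φ.extend (𝓡∂ 4)).target := (φ.extend (𝓡∂ 4)).map_source (by simpa using hwφ)
  have ha0 : 0 ≤ a 0 := by
    have : a ∈ range (𝓡∂ 4) := φ.extend_target_subset_range hatgt
    rw [range_modelWithCornersEuclideanHalfSpace] at this
    exact this
  have hκp : κ p = Λ a := by
    have h1 : κ p = ψ.extend (𝓡 4) x := by
      simp [hκdef, hpdef, hχdef]
    have h2 := hwritten a hatgt
    rw [h1, hΛA, ← h2, hadef, φ.extend_left_inv (I := 𝓡∂ 4) hwφ, hw]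
  -- the functional
  set M : (EuclideanSpace ℝ (Fin 4)) →L[ℝ] (EuclideanSpace ℝ (Fin 4)) := (Λe.symm : (EuclideanSpace ℝ (Fin 4)) →L[ℝ] (EuclideanSpace ℝ (Fin 4))).comp R with hMdef
  set π₀ : (EuclideanSpace ℝ (Fin 4)) →L[ℝ] ℝ := PiLp.proj (𝕜 := ℝ) 2 (fun _ : Fin 4 => ℝ) 0 with hπ₀def
  have hπ₀ : ∀ v : (EuclideanSpace ℝ (Fin 4)), π₀ v = v 0 := fun v => rfl
  set ℓ : (EuclideanSpace ℝ (Fin 4)) →L[ℝ] ℝ := π₀.comp M with hℓdef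
  have hℓapply : ∀ u, ℓ u = (Λe.symm (R u)) 0 := fun u => rfl
  refine ⟨ℓ, ?_, fun u hu => ?_⟩
  · -- `ℓ ≠ 0`
    intro hℓ0
    have h1 : ℓ (Re.symm (Λ (EuclideanSpace.single 0 1))) = 1 := by
      rw [hℓapply, ← hRe]
      simp [hΛe_symm]
    rw [hℓ0] at h1
    simp at h1
  -- the curve `t ↦ Λe⁻¹ (κ (p + t u))` in the chart `φ` of `W`
  set γ : ℝ → (EuclideanSpace ℝ (Fin 4)) := fun t => p + t • u with hγdef
  have hγ : ∀ t, HasDerivAt γ u t := fun t => by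
    simpa [hγdef] using ((hasDerivAt_id t).smul_const u).const_add p
  have hγ0 : γ 0 = p := by simp [hγdef]
  set kf : ℝ → (EuclideanSpace ℝ (Fin 4)) := fun t => Λe.symm (κ (γ t)) with hkfdef
  have hkf : HasDerivAt kf (M u) 0 := by
    have h1 : HasDerivAt (fun t => κ (γ t)) (R u) 0 := by
      have hκ' : HasFDerivAt κ R (γ 0) := hγ0 ▸ hκderiv
      exact hκ'.comp_hasDerivAt (0:ℝ) (hγ 0)
    exact (Λe.symm : (EuclideanSpace ℝ (Fin 4)) →L[ℝ] (EuclideanSpace ℝ (Fin 4))).hasFDerivAt.comp_hasDerivAt (0:ℝ) h1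
  have hkf0 : kf 0 = a := by simp [hkfdef, hγ0, hκp, hΛe_symm]
  have hcoord : HasDerivAt (fun t => kf t 0) (ℓ u) 0 :=
    π₀.hasFDerivAt.comp_hasDerivAt (0:ℝ) hkf
  -- eventually: interior, inside the target of `φ`, inside the source of `κ`
  have hev1 : ∀ᶠ t in 𝓝[>] (0:ℝ), 0 < kf t 0 :=
    eventually_nhdsGT_pos_of_hasDerivAt hcoord hu (by rw [hkf0]; exact ha0)
  have hev2 : ∀ᶠ t in 𝓝[>] (0:ℝ), kf t ∈ (φ.extend (𝓡∂ 4)).target := by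
    have ht : Tendsto kf (𝓝[>] 0) (𝓝[range (𝓡∂ 4)] a) := by
      rw [tendsto_nhdsWithin_iff]
      refine ⟨?_, ?_⟩
      · rw [← hkf0]
        exact hkf.continuousAt.tendsto.mono_left nhdsWithin_le_nhds
      · filter_upwards [hev1] with t ht
        rw [range_modelWithCornersEuclideanHalfSpace]
        exact ht.le
    exact ht (φ.extend_target_mem_nhdsWithin (I := 𝓡∂ 4) hwφ)
  have hev3 : ∀ᶠ t in 𝓝[>] (0:ℝ), γ t ∈ κ.source := by
    have hγc : Tendsto γ (𝓝[>] 0) (𝓝 p) := by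
      rw [← hγ0]
      exact ((hγ 0).continuousAt.tendsto).mono_left nhdsWithin_le_nhds
    exact hγc hκsrc_nhds
  filter_upwards [hev1, hev2, hev3] with t ht1 ht2 ht3
  -- names
  set q := γ t with hqdef
  set k := kf t with hkdef
  set y := (extChartAt (𝓡 4) x).symm q with hydef
  set w' := (φ.extend (𝓡∂ 4)).symm k with hw'def
  have hw'φ : w' ∈ φ.source := by
    have := (φ.extend (𝓡∂ 4)).map_target ht2
    rwa [OpenPartialHomeomorph.extend_source] at this
  have hφw' : φ.extend (𝓡∂ 4) w' = k := (φ.extend (𝓡∂ 4)).right_inv ht2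
  have hyψ : y ∈ ψ.source := by
    have := ht3
    simp only [hκdef, PartialEquiv.trans_source, PartialEquiv.symm_source, mem_inter_iff,
      mem_preimage, OpenPartialHomeomorph.extend_source] at this
    exact this.2
  have hew' : e w' = y := by
    have h1 : ψ.extend (𝓡 4) (e w') = Λ k := by
      rw [hΛA, ← hwritten k ht2]
    have h2 : Λ k = κ q := by
      change Λ (Λe.symm (κ (γ t))) = κ (γ t)
      rw [← hΛe, Λe.apply_symm_apply]
    have h3 : κ q = ψ.extend (𝓡 4) y := by
      simp [hκdef, hydef, hχdef]
    have hinj := (ψ.extend (𝓡 4)).injOn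
    rw [OpenPartialHomeomorph.extend_source] at hinj
    exact hinj (imm.source_subset_preimage_source hw'φ) hyψ (h1.trans (h2.trans h3))
  have hyS : y ∈ S i := hrange ▸ ⟨w', hew'⟩
  refine ⟨hyS, fun j hj hyj => ?_⟩
  -- if `y ∈ S j`, then `w'` would be a boundary point, but `φ` sends it to the interior
  obtain ⟨w'', hw''bd, hw''⟩ := hbd j hj ⟨hyS, hyj⟩
  have heq : w'' = w' := hemb.isEmbedding.injective (hw''.trans hew'.symm)
  rw [heq] at hw''bd
  have hint : (𝓡∂ 4).IsInteriorPoint w' := by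
    refine isInteriorPoint_of_mem_maximalAtlas (I := 𝓡∂ 4) (n := ∞) (by simp) hφatlas hw'φ ?_
    rw [hφw', interior_range_modelWithCornersEuclideanHalfSpace]
    exact ht1
  exact (ModelWithCorners.isInteriorPoint_iff_not_isBoundaryPoint w').mp hint hw''bd

end Sector

/-! ### Assembly -/

section Main

universe u

variable {X : Type u} [TopologicalSpace X] [ChartedSpace (EuclideanSpace ℝ (Fin 4)) X]
  {g : ℕ} {k : Fin 3 → ℕ} {S : Fin 3 → Set X}

/-- **The vendored trisection predicate is unsatisfiable.** No family of three subsets of any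
space charted on `ℝ⁴` is a trisection in the sense of `Literature.Topology.FourManifolds.IsTrisection`: the sectors of an actual
Gay–Kirby trisection are manifolds with *corners* along the central surface, whereas
`IsTrisection` demands smoothly embedded manifolds with boundary meeting pairwise along their
boundaries at a common point, which is impossible to first order (three pairwise disjoint open
half-spaces); in Gay–Kirby's Def. 1 the `Xᵢ` have corners along `F_g`. [cite: GayKirby2016, Def. 1 (p. 2)] -/
theorem not_isTrisection : ¬ IsTrisection X g k S := by
  rintro ⟨-, hsec, hpair⟩
  -- Part 1: a triple point, from the handlebody `H₀₁`
  obtain ⟨H, _, _, hh, hHc, -, ⟨f, hfa, hcount⟩, hhemb, -, hhbd⟩ := hpair 0 1 (by decide)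
  have hne : Nonempty H := by
    have h0 := hcount 0
    simp only [handleCount_zero] at h0
    obtain ⟨a, -⟩ := Set.ncard_eq_one.mp h0
    exact ⟨a⟩
  have htop : (criticalSetOfIndex (𝓡∂ 3) f 3).ncard = 0 := by
    rw [hcount 3]; exact handleCount_of_two_le 1 g (by norm_num)
  have hatlas : ∀ z : H, ∃ φ ∈ IsManifold.maximalAtlas (𝓡∂ 3) ∞ H, z ∈ φ.source := fun z =>
    ⟨_, (hhemb.isImmersion.isImmersionAt z).domChart_mem_maximalAtlas,
      (hhemb.isImmersion.isImmersionAt z).mem_domChart_source⟩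
  obtain ⟨z, hz⟩ := boundary_nonempty_of_isMorse (m := 2) hfa.isMorse htop hatlas
  have hx : ∀ i, hh z ∈ S i := by
    have : hh z ∈ ⋂ l, S l := hhbd ▸ mem_image_of_mem hh hz
    exact fun i => mem_iInter.mp this i
  -- Part 2: one half-space of directions per sector, pairwise disjoint
  have hℓ : ∀ i, ∃ ℓ : EuclideanSpace ℝ (Fin 4) →L[ℝ] ℝ, ℓ ≠ 0 ∧ ∀ u, 0 < ℓ u →
      ∀ᶠ t in 𝓝[>] (0:ℝ),
      (extChartAt (𝓡 4) (hh z)).symm (extChartAt (𝓡 4) (hh z) (hh z) + t • u) ∈ S i ∧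
      ∀ j, j ≠ i → (extChartAt (𝓡 4) (hh z)).symm (extChartAt (𝓡 4) (hh z) (hh z) + t • u) ∉ S j := by
    intro i
    obtain ⟨W, _, _, e, -, -, -, hemb, hrange, hbd⟩ := hsec i
    exact sector_halfSpace hemb hrange hbd (hx i)
  choose ℓ hℓne hℓgood using hℓ
  refine three_halfSpaces (fun i => (ℓ i : EuclideanSpace ℝ (Fin 4) →ₗ[ℝ] ℝ)) (fun i h => hℓne i ?_) ?_
  · ext v; simpa using LinearMap.congr_fun h v
  · rintro i j hij u ⟨hi, hj⟩
    obtain ⟨t, ⟨-, hti⟩, htj, -⟩ := ((hℓgood i u hi).and (hℓgood j u hj)).exists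
    exact hti j (Ne.symm hij) htj

/-- In particular there are no balanced trisections. [cite: GayKirby2016, Def. 1] -/
theorem not_isBalancedTrisection {g k : ℕ} : ¬ IsBalancedTrisection X g k S :=
  not_isTrisection

/-- The trisection genus of every `X` is `⊤` for the vendored predicate. [cite: GayKirby2016, Remark 2] -/
theorem trisectionGenus_eq_top : trisectionGenus X = ⊤ := by
  simp only [trisectionGenus, iInf_eq_top]
  intro g k S h
  exact (not_isTrisection h).elim

-- names the `@[deprecated]` record `exists_isBalancedTrisection` of `Trisections.lean` on purpose: this IS its
-- refutation (verdict clean-up 2026-08-15); REMOVE-WHEN the record is deleted from `Trisections.lean`.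
set_option linter.deprecated false in
/-- **`exists_isBalancedTrisection` is refuted by any closed connected oriented smooth 4-manifold.**
As soon as one closed, connected, oriented smooth 4-manifold `X : Type u` is exhibited, the named
fact `Literature.exists_isBalancedTrisection.{u}` (vendored form of Gay–Kirby 2016, Thm. 4) is false, because
`Literature.Topology.FourManifolds.IsTrisection` is unsatisfiable (`not_isTrisection`). The mathematical theorem is of course true;
the vendored *statement* is not faithful (sectors must be allowed corners). [cite: GayKirby2016, Thm 4] -/
theorem not_exists_isBalancedTrisection_of (X : Type u) [TopologicalSpace X] [T2Space X]
    [SecondCountableTopology X] [ChartedSpace (EuclideanSpace ℝ (Fin 4)) X]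
    [IsManifold (𝓡 4) ∞ X] [CompactSpace X] [ConnectedSpace X] (o : SmoothOrientation (𝓡 4) X) :
    ¬ exists_isBalancedTrisection.{u} := by
  intro h
  obtain ⟨g, k, S, -, hS⟩ := h X o
  exact not_isTrisection hS

-- names the `@[deprecated]` record `exists_isBalancedTrisection` of `Trisections.lean` on purpose: this IS its
-- refutation (verdict clean-up 2026-08-15); REMOVE-WHEN the record is deleted from `Trisections.lean`.
set_option linter.deprecated false in
/-- With the named fact `Literature.Topology.FourManifolds.isOrientable_sphere` (spheres are orientable) the round 4-sphere
`S⁴ ⊂ ℝ⁵` is a closed connected oriented smooth 4-manifold in `Type`, so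
`Literature.exists_isBalancedTrisection.{0}` fails: hypotheses `h₁` and `h₆` of the thesis
`SmoothPoincare4/GroupTrisection` are jointly inconsistent. [cite: GayKirby2016, Thm 4] -/
theorem not_exists_isBalancedTrisection_of_isOrientable_sphere (hS : isOrientable_sphere) :
    ¬ exists_isBalancedTrisection.{0} := by
  haveI : ConnectedSpace (Metric.sphere (0 : EuclideanSpace ℝ (Fin 5)) 1) := by
    refine isConnected_iff_connectedSpace.mp (isConnected_sphere ?_ 0 zero_le_one)
    rw [← Module.finrank_eq_rank, finrank_euclideanSpace_fin]
    norm_num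
  obtain ⟨o⟩ := hS 4
  exact not_exists_isBalancedTrisection_of (Metric.sphere (0 : EuclideanSpace ℝ (Fin 5)) 1) o

-- names the `@[deprecated]` record `exists_isBalancedTrisection` of `Trisections.lean` on purpose: this IS its
-- refutation (verdict clean-up 2026-08-15); REMOVE-WHEN the record is deleted from `Trisections.lean`.
set_option linter.deprecated false in
/-- **`Literature.exists_isBalancedTrisection.{0}` is false**, unconditionally: the round `S⁴ ⊂ ℝ⁵` is a
closed connected smooth 4-manifold in `Type`, oriented by `Literature.Topology.FourManifolds.isOrientable_sphere_holds`
(`SmoothOrientationSphereProofs.lean`), and no manifold has an `IsTrisection`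
(`not_isTrisection`).  The vendored form of Gay–Kirby's Theorem 4 is therefore refuted as stated;
the faithful vendoring is `Literature.Topology.FourManifolds.exists_isBalancedGKTrisection` over the corrected predicate.
[cite: GayKirby2016, Thm 4] -/
theorem not_exists_isBalancedTrisection : ¬ exists_isBalancedTrisection.{0} :=
  not_exists_isBalancedTrisection_of_isOrientable_sphere isOrientable_sphere_holds

end Main

end TrisectionRefutation

end Literature.Topology.FourManifolds
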